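import Summits.NavierStokesRegularity.NavierStokesRegularity.Theorems.ArgmaxDoorsDefs
import Summits.NavierStokesRegularity.NavierStokesRegularity.Theorems.ArgmaxDoorsDepletionIntegrand
import Literature.Analysis.FluidPDE.BiotSavartRepresentationSqIntegrable
import Literature.Analysis.FluidPDE.TaoEnstrophyLocalisation
import HarnessLib

/-!
# ArgmaxDoorsDepletion — door family S35 «ArgmaxDoors», plate D «PointDepletion», PROVED

S-door lane (ns-sfl-p1 g5, first-announce 2026-08-28T15:20:30Z; LEAD ns-s30-p1 g3; texts of record nsreg-p1 g29
ROUND-33 `r33/Sketch35.lean` v3 sha16 93168f45ce53c5c4 = tree P0 `Theorems/ArgmaxDoorsDefs.lean` p645080;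
`--supports stmt-NavierStokesRegularity-0056 --as helper`).

`pointDepletion_holds : PointDepletion` BY NAME against P0 — Constantin–Fefferman's geometric depletion of vortex
stretching at ONE point, for every slice of the classical frame: with the universal constant `A` of the tree's
`exists_abs_inner_fderiv_biotSavart_le` (`VorticityDirectionDepletion`),
`⟪ω,(∇u)ω⟫(x,t) ≤ A·|ω(x,t)|²·∫ |ω(y) − ⟪ω(y),ξ(x)⟫ξ(x)| |x−y|⁻³ dy`, `ξ = ω/|ω|`, and the integrand is
integrable.

Steps (all by name from the tree + the two tools files):
* slice data: `v = u(t)` is `C^∞` (`IsClassicalNSSolutionOn.contDiff_velocity`), divergence free, and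
  `v, curl v ∈ L²` from `HasBoundedSobolevNormsOn (Icc 0 t)` at orders `0, 1` (`lintegral_curl_sq_le`), hence
  `v = K ∗ curl v` (`biotSavart_curl_eq_self_of_lintegral_sq_lt_top`);
* `inner_fderiv_le_add_tail` — at radius `R`: `ω = χ_R ω + (1 − χ_R) ω` (`suppCutoff x₀ R`); the compact
  Lipschitz part is depleted (`exists_abs_inner_fderiv_biotSavart_le`, majorant `χ_R G ≤ G`), the far part is
  differentiable at `x₀` with gradient `≤ 8A' ∫_{|x₀−y|≥R}‖ω‖|x₀−y|⁻³` (`hasFDerivAt_biotSavart_far`), and the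
  Biot–Savart integral is additive near `x₀`; so `⟪ξ, ∇v(x₀) ξ⟫ ≤ A ∫ G + 8A'·tail(R)`;
* `pointDepletion_holds` — `R = n + 1 → ∞` (`tendsto_integral_norm_mul_farCube`, `ge_of_tendsto'`), then multiply
  by `|ω(x₀)|²` (`ω(x₀) = |ω(x₀)| ξ`).

WHAT THIS IS NOT: the plate of a regularity CRITERION (door S35-C «ArgmaxCoherenceDoor») about hypothetical
blow-up; item 0056 `NoTypeII` and NS regularity are NOT proved; nothing here is a route or a summit statement.
-/

-- the summit's problem namespace repeats the summit name (tree layout)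
set_option linter.dupNamespace false

noncomputable section

open MeasureTheory Set Function Filter Metric Real InnerProductSpace
open scoped ENNReal NNReal RealInnerProductSpace Topology ContDiff

namespace Summit.NavierStokesRegularity.NavierStokesRegularity.Theorems.ArgmaxDoors

open Literature.Analysis.FluidPDE

/-! ### One truncation radius: near part depleted, far part small -/

/-- **The stretching rate at a point, split at radius `R`.** Let `A` carry the depleted bound of
`exists_abs_inner_fderiv_biotSavart_le`, `K = biotSavartCLM` with `IsC1SingularKernel K A'`, `v ∈ C²` with
`v = K ∗ curl v` and `∫‖curl v‖² < ∞`, `e` a unit vector with `curl v(x₀) = ‖curl v(x₀)‖ e`, and the depletion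
integrand integrable. Then for every `R > 0`,
`⟪e, ∇v(x₀) e⟫ ≤ A ∫ ‖ω(y) − ⟪ω(y),e⟫e‖ |x₀−y|⁻³ dy + 8A' ∫_{|x₀−y| ≥ R} ‖ω(y)‖ |x₀−y|⁻³ dy`:
split `ω = χ_R ω + (1 − χ_R) ω` (`χ_R = suppCutoff x₀ R`), the compact Lipschitz part is depleted by the tree
lemma (majorant `χ_R · G ≤ G`), the far part by `hasFDerivAt_biotSavart_far`. -/
theorem inner_fderiv_le_add_tail {A : ℝ} (hA : 0 ≤ A)
    (hdep : ∀ ⦃γ C : ℝ≥0⦄ (_ : 0 < γ)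
      ⦃f : (EuclideanSpace ℝ (Fin 3)) → (EuclideanSpace ℝ (Fin 3))⦄ (_ : HolderWith C γ f)
      (_ : HasCompactSupport f) ⦃x e : (EuclideanSpace ℝ (Fin 3))⦄ (_ : ‖e‖ = 1) (_ : ∃ c : ℝ, f x = c • e)
      ⦃g : (EuclideanSpace ℝ (Fin 3)) → ℝ⦄ (_ : Integrable g)
      (_ : ∀ y, y ≠ x → A * ‖f y - ⟪f y, e⟫ • e‖ * (‖x - y‖ ^ 3)⁻¹ ≤ g y),
      |⟪e, fderiv ℝ (biotSavart f) x e⟫| ≤ ∫ y, g y)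
    {A' : ℝ} (hK : IsC1SingularKernel biotSavartCLM A')
    {v : EuclideanSpace ℝ (Fin 3) → EuclideanSpace ℝ (Fin 3)} (hv : ContDiff ℝ 2 v)
    (hrep : biotSavart (curl v) = v) (hw2 : Integrable fun y => ‖curl v y‖ ^ 2)
    {x₀ e : EuclideanSpace ℝ (Fin 3)} (he : ‖e‖ = 1) (hpar : curl v x₀ = ‖curl v x₀‖ • e)
    (hG : Integrable fun y => ‖curl v y - ⟪curl v y, e⟫ • e‖ * (‖x₀ - y‖ ^ 3)⁻¹)
    {R : ℝ} (hR : 0 < R) :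
    ⟪e, fderiv ℝ v x₀ e⟫ ≤ A * (∫ y, ‖curl v y - ⟪curl v y, e⟫ • e‖ * (‖x₀ - y‖ ^ 3)⁻¹) +
      8 * A' * ∫ y, ‖curl v y‖ *
        (ball (0 : EuclideanSpace ℝ (Fin 3)) R)ᶜ.indicator (fun z => (‖z‖ ^ 3)⁻¹) (x₀ - y) := by
  have hA' : 0 ≤ A' := hK.nonneg
  have hw1 : ContDiff ℝ 1 (curl v) := contDiff_curl (n := 1) (by exact hv)
  have hwc : Continuous (curl v) := hw1.continuous
  have hχ : ContDiff ℝ 1 (suppCutoff x₀ R) := contDiff_suppCutoff x₀ R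
  have hχc : HasCompactSupport (suppCutoff x₀ R) := hasCompactSupport_suppCutoff x₀ hR
  -- near part `f = χ ω` and far part `h = (1 − χ) ω` as genuine variables
  obtain ⟨f, hf_def⟩ : ∃ f : EuclideanSpace ℝ (Fin 3) → EuclideanSpace ℝ (Fin 3),
      f = fun y => suppCutoff x₀ R y • curl v y := ⟨_, rfl⟩
  obtain ⟨h, hh_def⟩ : ∃ h : EuclideanSpace ℝ (Fin 3) → EuclideanSpace ℝ (Fin 3),
      h = fun y => (1 - suppCutoff x₀ R y) • curl v y := ⟨_, rfl⟩
  have hfh : ∀ y, f y + h y = curl v y := by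
    intro y
    rw [hf_def, hh_def]
    simp only
    rw [← add_smul, add_sub_cancel, one_smul]
  have hf1 : ContDiff ℝ 1 f := by rw [hf_def]; exact hχ.smul hw1
  have hfc : HasCompactSupport f := by rw [hf_def]; exact hχc.smul_right
  have hfcont : Continuous f := hf1.continuous
  obtain ⟨C, hC⟩ := hf1.lipschitzWith_of_hasCompactSupport hfc one_ne_zero
  have hHolder : HolderWith C 1 f := hC.holderWith
  -- `f(x₀) = ω(x₀)` is parallel to `e`
  have hχx₀ : suppCutoff x₀ R x₀ = 1 := suppCutoff_eq_one hR (by rw [sub_self, norm_zero]; exact hR.le)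
  have hfx : ∃ c : ℝ, f x₀ = c • e := ⟨‖curl v x₀‖, by rw [hf_def]; simp only; rw [hχx₀, one_smul, ← hpar]⟩
  -- the majorant `A χ G ≤ A G`
  have hdom : ∀ y, y ≠ x₀ → A * ‖f y - ⟪f y, e⟫ • e‖ * (‖x₀ - y‖ ^ 3)⁻¹ ≤
      A * (‖curl v y - ⟪curl v y, e⟫ • e‖ * (‖x₀ - y‖ ^ 3)⁻¹) := by
    intro y _
    have h1 : f y - ⟪f y, e⟫ • e = suppCutoff x₀ R y • (curl v y - ⟪curl v y, e⟫ • e) := by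
      rw [hf_def]
      simp only
      rw [real_inner_smul_left, smul_sub, mul_smul]
    rw [h1, norm_smul, Real.norm_eq_abs]
    have hχ1 : |suppCutoff x₀ R y| ≤ 1 := abs_suppCutoff_le_one x₀ R y
    have hN : 0 ≤ ‖curl v y - ⟪curl v y, e⟫ • e‖ := norm_nonneg _
    have hI : 0 ≤ (‖x₀ - y‖ ^ 3)⁻¹ := by positivity
    calc A * (|suppCutoff x₀ R y| * ‖curl v y - ⟪curl v y, e⟫ • e‖) * (‖x₀ - y‖ ^ 3)⁻¹
        ≤ A * (1 * ‖curl v y - ⟪curl v y, e⟫ • e‖) * (‖x₀ - y‖ ^ 3)⁻¹ := by gcongr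
      _ = A * (‖curl v y - ⟪curl v y, e⟫ • e‖ * (‖x₀ - y‖ ^ 3)⁻¹) := by ring
  have hnear : |⟪e, fderiv ℝ (biotSavart f) x₀ e⟫| ≤
      A * ∫ y, ‖curl v y - ⟪curl v y, e⟫ • e‖ * (‖x₀ - y‖ ^ 3)⁻¹ := by
    have h1 := hdep one_pos hHolder hfc he hfx (hG.const_mul A) hdom
    rwa [integral_const_mul] at h1
  -- the far part
  have hhc : Continuous h := by
    rw [hh_def]; exact (continuous_const.sub hχ.continuous).smul hwc
  have hhle : ∀ y, ‖h y‖ ≤ ‖curl v y‖ := by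
    intro y
    rw [hh_def]
    simp only
    rw [norm_smul, Real.norm_eq_abs]
    have h01 : |1 - suppCutoff x₀ R y| ≤ 1 := by
      rw [abs_le]
      constructor <;> linarith [suppCutoff_nonneg x₀ R y, suppCutoff_le_one x₀ R y]
    exact mul_le_of_le_one_left (norm_nonneg _) h01
  have hh2 : Integrable fun y => ‖h y‖ ^ 2 := by
    refine hw2.mono' ((hhc.norm.pow 2).aestronglyMeasurable) (Eventually.of_forall fun y => ?_)
    rw [Real.norm_of_nonneg (sq_nonneg _)]
    exact pow_le_pow_left₀ (norm_nonneg _) (hhle y) 2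
  have hvan : ∀ y, ‖y - x₀‖ < R → h y = 0 := by
    intro y hy
    rw [hh_def]
    simp only
    rw [suppCutoff_eq_one hR hy.le, sub_self, zero_smul]
  obtain ⟨hint, hderiv, hbound⟩ := hasFDerivAt_biotSavart_far hK hhc hh2 hR hvan
  -- linearity of the Biot–Savart integral near `x₀`
  have hEq : v =ᶠ[𝓝 x₀] fun x => biotSavart f x + biotSavart h x := by
    filter_upwards [Metric.ball_mem_nhds x₀ (half_pos hR)] with x hx
    rw [mem_ball, dist_eq_norm] at hx
    have hfi : Integrable fun y => biotSavartKernel (x - y) (f y) :=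
      integrable_biotSavartKernel_sub_apply_of_hasCompactSupport hfcont hfc x
    have hhi : Integrable fun y => biotSavartKernel (x - y) (h y) := hint x hx
    have hsum : biotSavart f x + biotSavart h x =
        ∫ y, (biotSavartKernel (x - y) (f y) + biotSavartKernel (x - y) (h y)) := by
      unfold biotSavart
      rw [integral_add hfi hhi]
    rw [hsum, ← congrFun hrep x]
    unfold biotSavart
    refine integral_congr_ae (Eventually.of_forall fun y => ?_)
    show biotSavartKernel (x - y) (curl v y) = biotSavartKernel (x - y) (f y) + biotSavartKernel (x - y) (h y)
    rw [← biotSavartCLM_apply, ← biotSavartCLM_apply, ← biotSavartCLM_apply, ← map_add, hfh]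
  -- the derivative of `v` at `x₀`
  have hDf : HasFDerivAt (biotSavart f) (fderiv ℝ (biotSavart f) x₀) x₀ :=
    (((contDiff_biotSavart one_pos hHolder hfc).differentiable one_ne_zero) x₀).hasFDerivAt
  have hDv : HasFDerivAt v
      (fderiv ℝ (biotSavart f) x₀ + ∫ y, (fderiv ℝ biotSavartCLM (x₀ - y)).flip (h y)) x₀ :=
    (hDf.add hderiv).congr_of_eventuallyEq hEq
  rw [hDv.fderiv, _root_.add_apply, inner_add_right]
  -- collect
  have h1 : ⟪e, fderiv ℝ (biotSavart f) x₀ e⟫ ≤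
      A * ∫ y, ‖curl v y - ⟪curl v y, e⟫ • e‖ * (‖x₀ - y‖ ^ 3)⁻¹ := (le_abs_self _).trans hnear
  have h2 : ⟪e, (∫ y, (fderiv ℝ biotSavartCLM (x₀ - y)).flip (h y)) e⟫ ≤
      ‖∫ y, (fderiv ℝ biotSavartCLM (x₀ - y)).flip (h y)‖ := by
    calc ⟪e, (∫ y, (fderiv ℝ biotSavartCLM (x₀ - y)).flip (h y)) e⟫
        ≤ ‖e‖ * ‖(∫ y, (fderiv ℝ biotSavartCLM (x₀ - y)).flip (h y)) e‖ := real_inner_le_norm _ _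
      _ ≤ ‖e‖ * (‖∫ y, (fderiv ℝ biotSavartCLM (x₀ - y)).flip (h y)‖ * ‖e‖) := by
          gcongr
          exact ContinuousLinearMap.le_opNorm _ _
      _ = ‖∫ y, (fderiv ℝ biotSavartCLM (x₀ - y)).flip (h y)‖ := by rw [he]; ring
  have h4 : ∫ y, ‖h y‖ * (ball (0 : EuclideanSpace ℝ (Fin 3)) R)ᶜ.indicator (fun z => (‖z‖ ^ 3)⁻¹) (x₀ - y) ≤
      ∫ y, ‖curl v y‖ * (ball (0 : EuclideanSpace ℝ (Fin 3)) R)ᶜ.indicator (fun z => (‖z‖ ^ 3)⁻¹) (x₀ - y) := by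
    refine integral_mono_of_nonneg (Eventually.of_forall fun y => ?_)
      (integrable_norm_mul_farCube hwc hw2 x₀ hR) (Eventually.of_forall fun y => ?_)
    · exact mul_nonneg (norm_nonneg _) (farKernel_nonneg 3 R _)
    · exact mul_le_mul_of_nonneg_right (hhle y) (farKernel_nonneg 3 R _)
  have h5 := mul_le_mul_of_nonneg_left h4 (by positivity : (0 : ℝ) ≤ 8 * A')
  linarith

/-! ### The plate -/

/-- plate D «PointDepletion» of door family S35 «ArgmaxDoors» (nsreg-p1 ROUND-33, P0 `ArgmaxDoorsDefs`), PROVED: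
Constantin–Fefferman's depletion at ONE point for the class. With the universal constant `A` of
`exists_abs_inner_fderiv_biotSavart_le`: for every classical unforced solution in the frame, every `t ∈ [0,T)`
and every `x` with `ω(x,t) ≠ 0`, the depletion integrand is integrable and
`⟪ω,(∇u)ω⟫(x,t) ≤ A·|ω(x,t)|²·∫ |ω(y) − ⟪ω(y),ξ(x)⟫ξ(x)| |x−y|⁻³ dy`. Proof: the slice `v = u(t)` is
`C^∞`, divergence free, with `v, curl v ∈ L²` (`HasBoundedSobolevNormsOn`), so `v = K ∗ curl v`
(`biotSavart_curl_eq_self_of_lintegral_sq_lt_top`); `inner_fderiv_le_add_tail` at `R = n + 1` and the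
vanishing tail (`tendsto_integral_norm_mul_farCube`) give `⟪ξ, ∇v(x) ξ⟫ ≤ A ∫ G`; multiply by `|ω(x)|²`. -/
theorem pointDepletion_holds : PointDepletion := by
  obtain ⟨A, hA0, hdep⟩ := exists_abs_inner_fderiv_biotSavart_le
  obtain ⟨A', hK⟩ := exists_isC1SingularKernel_biotSavartCLM
  refine ⟨A, hA0, ?_⟩
  intro ν T u p hsol hreg t ht x₀ hx
  -- slice data
  have hv : ContDiff ℝ ∞ (u t) := hsol.contDiff_velocity ht
  have hv2 : ContDiff ℝ 2 (u t) := hv.of_le (by norm_cast)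
  have hdiv : VectorCalculus.IsDivFree (u t) := hsol.divFree t ht
  have hB : HasBoundedSobolevNormsOn (Icc 0 t) u := hreg t ht.2
  have htI : t ∈ Icc 0 t := ⟨ht.1, le_rfl⟩
  obtain ⟨C₀, hC₀⟩ := hB 0
  obtain ⟨C₁, hC₁⟩ := hB 1
  have hv2' : ∫⁻ y, ‖u t y‖ₑ ^ 2 < ⊤ := by
    have h' : ∫⁻ y, ‖u t y‖ₑ ^ 2 ≤ C₀ := by
      refine le_of_eq_of_le (lintegral_congr fun y => ?_) (hC₀ t htI)
      rw [← ofReal_norm, ← ofReal_norm, norm_iteratedFDeriv_zero]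
    exact lt_of_le_of_lt h' ENNReal.coe_lt_top
  have hw2' : ∫⁻ y, ‖curl (u t) y‖ₑ ^ 2 < ⊤ :=
    lt_of_le_of_lt ((lintegral_curl_sq_le (u t)).trans (mul_le_mul' le_rfl (hC₁ t htI)))
      (ENNReal.mul_lt_top ENNReal.ofReal_lt_top ENNReal.coe_lt_top)
  have hrep : biotSavart (curl (u t)) = u t :=
    biotSavart_curl_eq_self_of_lintegral_sq_lt_top hv2 hdiv hv2' hw2'
  have hw1 : ContDiff ℝ 1 (curl (u t)) := contDiff_curl (n := 1) (by exact hv2)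
  have hwc : Continuous (curl (u t)) := hw1.continuous
  have hw2i : Integrable fun y => ‖curl (u t) y‖ ^ 2 := integrable_sq_norm_of_lintegral_lt_top hwc hw2'
  have hG := integrable_depletionIntegrand hw1 hw2i x₀
  refine ⟨hG, ?_⟩
  -- the direction at `x₀`
  have he : ‖vorticityDirection (curl (u t)) x₀‖ = 1 := norm_vorticityDirection _ hx
  have hpar : curl (u t) x₀ = ‖curl (u t) x₀‖ • vorticityDirection (curl (u t)) x₀ :=
    (VorticityDirectionDynamics.norm_smul_vorticityDirection _ _).symm
  -- every truncation radius `n + 1`, then `n → ∞`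
  have hstep : ∀ n : ℕ, ⟪vorticityDirection (curl (u t)) x₀,
      fderiv ℝ (u t) x₀ (vorticityDirection (curl (u t)) x₀)⟫ ≤ A * depletionIntegral u t x₀ +
      8 * A' * ∫ y, ‖curl (u t) y‖ *
        (ball (0 : EuclideanSpace ℝ (Fin 3)) ((n : ℝ) + 1))ᶜ.indicator (fun z => (‖z‖ ^ 3)⁻¹) (x₀ - y) :=
    fun n => inner_fderiv_le_add_tail hA0 hdep hK hv2 hrep hw2i he hpar hG (by positivity)
  have hlim := tendsto_integral_norm_mul_farCube hwc hw2i x₀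
  have hle : ⟪vorticityDirection (curl (u t)) x₀,
      fderiv ℝ (u t) x₀ (vorticityDirection (curl (u t)) x₀)⟫ ≤ A * depletionIntegral u t x₀ := by
    have h2 := tendsto_const_nhds (x := A * depletionIntegral u t x₀).add (hlim.const_mul (8 * A'))
    rw [mul_zero, add_zero] at h2
    exact ge_of_tendsto' h2 hstep
  -- multiply by `|ω(x₀)|²`
  calc ⟪curl (u t) x₀, fderiv ℝ (u t) x₀ (curl (u t) x₀)⟫
      = ‖curl (u t) x₀‖ ^ 2 * ⟪vorticityDirection (curl (u t)) x₀,
          fderiv ℝ (u t) x₀ (vorticityDirection (curl (u t)) x₀)⟫ := by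
        conv_lhs => rw [hpar]
        rw [map_smul, real_inner_smul_left, real_inner_smul_right]
        ring
    _ ≤ ‖curl (u t) x₀‖ ^ 2 * (A * depletionIntegral u t x₀) := mul_le_mul_of_nonneg_left hle (sq_nonneg _)
    _ = A * ‖curl (u t) x₀‖ ^ 2 * depletionIntegral u t x₀ := by ring

end Summit.NavierStokesRegularity.NavierStokesRegularity.Theorems.ArgmaxDoors

end
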